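import Summits.BirchSwinnertonDyer.Rank1Residual.X1.RankOne
import Summits.BirchSwinnertonDyer.BirchSwinnertonDyer.Theorems.Rank1ResidualX1Isogeny
import HarnessLib

/-!
# Residual class X1 ∩ {r = 1}: the LW-free per-pair route in MODULAR-SYMBOL currency —
# `p ∤ #Ш_an` + `[T¹]L_p(E,T) ≠ 0` ⇒ Mazur's main conjecture ∧ `BSD(E,p)` on the rank-one leaf

HONEST FRAMING (cell `b2b-bsdres`, run/shared/lean/b2b/bsd-rank1-residual/, verbatim in every
file): the goal of the cell is to DELETE the COMBINATION-SHAPED residual classes of the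
Birch–Swinnerton-Dyer formula for ALL analytic-rank `≤ 1` elliptic curves over `ℚ` — "full BSD
formula for every rank `≤ 1` curve in class `C`" assembled STRICTLY from published theorems — so
that the rank-`≤ 1` remainder becomes exactly the CONSTRUCTION-SHAPED classes, which are TYPED
(missing-input `Prop`s), NOT attempted. This is not "finishing BSD". CLASS-OWNERS.md (2026-08-20):
row "X1 (r = 1)" — research route; NO CLAIM BEYOND STATED CLASSES; no label change. PER-PAIR
certificate shape, not a class theorem; nothing is booked by this file.

Unit `b2b-bsdres-x1a` (X1 prover A, gen 10). Fifth sequel of `X1/RankOne.lean`.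

## Why (2026-08-20)
Referee R95.2 / ref-2 R2-33.2: Lawson–Wuthrich 2016 Thm. 14 in the REDUCIBLE case is disputed in print
(Matar–Nekovář, JTNB 31 (2019) 455–501, p. 457 §0.10–0.11: "the current state of the art requires an
irreducibility assumption for `ρ_{E,p}` … in order to obtain, by Kolyvagin's method, an upper bound on
the size of `Ш(E/K)[p^∞]` without any error terms"). Every X1 pair has `E[p]` reducible, so the lane's
Heegner-index closures (row T-LW) of rank-one X1 pairs — 2 404 class-pairs with `N < 5·10⁵`, 195 with
`N < 2·10⁴` (x1a gen 10, `HOME/b2b-bsdres-x1a/gen10/LW-FALLOUT-X1.md`) — are CONTESTED, and the third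
route of `X1/RankOneHeegnerIndex.lean` is a conditional shape only. The published per-pair route that
remains is route B of `X1/RankOne.lean` §3 (`Leaf.mazurMainConjecture_and_bsdp_of_shaAn_unit_of_schneider`):
Wuthrich 2014 Thm. 16 (Kato's divisibility integrally in `Λ`, PRINTED for `E[p]` reducible), Schneider
1985 / Perrin-Riou (BMS Thm. 1.7, odd `p`), Perrin-Riou 1987 (`p`-adic Gross–Zagier), Mazur–Tate sigma,
modularity, GZK — none of which uses Kolyvagin's method at `p` or an irreducibility hypothesis — with two
finite certificates per pair: `p ∤ #Ш_an` and Schneider's non-degeneracy `Reg_p ≠ 0`.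

## What this file adds
The same route with the Schneider certificate replaced by the quantity a MODULAR-SYMBOL engine
computes: the linear coefficient of the cyclotomic `p`-adic `L`-series (Perrin-Riou 1987 makes the two
equivalent on the leaf, `Leaf.coeff_one_ne_zero_iff_schneider`, gen 9).
* `Leaf.mazurMainConjecture_and_bsdp_of_shaAn_unit_of_coeff_one_ne_zero` — leaf pair, `p ∤ #Ш_an`,
  `[T¹]L_p(f,α,T) ≠ 0` for SOME newform `f` of `E` ⇒ Mazur's main conjecture at `(E,p)` ∧ `BSD(E,p)`;
  `Leaf.bsdp_of_shaAn_unit_of_coeff_one_ne_zero` the `BSD` half.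
* `coeff_one_ne_zero_of_le_norm_coeff_one_smul` — the finite-precision form of the certificate: a
  positive LOWER BOUND `c ≤ ‖[T¹](ϖ·L_p(f,α))‖_p` for any scalar `ϖ` (e.g. the Néron normalisation
  `ϖ·Ω_E = Ω⁺_f` the engines use; what "`c₁ ≢ 0 (mod p^{v+1})`" certifies, with `c = p^{-v}`) gives
  `[T¹]L_p(f,α) ≠ 0`.
* `Leaf.mazurMainConjecture_and_bsdp_of_shaAn_unit_of_le_norm_coeff_one` — the route in that currency:
  leaf pair + `p ∤ #Ш_an` + `p^{-v} ≤ ‖[T¹](ϖ·L_p(f,α))‖_p` for some `v : ℕ` ⇒ MC ∧ `BSD(E,p)`.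
  This GENERALISES x1b's one-number route P₁ (`Leaf.mazurMainConjecture_and_bsdp_of_norm_coeff_one_eq_one`,
  `v = 0`, no `#Ш_an` input) to every finite `v` at the price of the `#Ш_an` certificate; on the
  anomalous leaf `v ≥ 1` is the typical case (the leading coefficient carries the anomalous factor
  `(1 − α⁻¹)²`, Burungale–Skinner 2023 §2; on type B `λ_an ≥ 3`, X1-CHAIN §17c).

* §3 (appended, gen 10): the CLASS form the lane books (UNIT = `ℚ`-isogeny class): `Leaf.of_isIsogenous`
  (the leaf is isogeny-invariant: `ClassX1.of_isIsogenous` + Knapp Thm. 11.67), and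
  `Leaf.bsdp_of_isIsogenous_of_shaAn_unit_of_coeff_one_ne_zero` / `…_of_le_norm_coeff_one` — the two
  certificate bits may be read on ANY globally minimal curve `E'` of the class (`p ∤ #Ш_an(E')`,
  `[T¹]L_p(f,α) ≠ 0` for a newform `f` of `E'`), and `BSD(E,p)` follows for every `E ∼ E'`
  (Cassels' isogeny invariance, `Rank1ResidualX1Isogeny.bsdp_iff_of_isIsogenous`).

* §4 (appended, gen 10): BOOKING FORM — the `L_p`-certificate is class data (same newform for every
  member — equal `L`-functions, Knapp Thm. 11.67; same unit root, `Leaf.unitRoot_eq_of_isIsogenous`), the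
  `#Ш_an` bit is read on any member: `Leaf.bsdp_of_coeff_one_ne_zero_of_isIsogenous_shaAn_unit`,
  `Leaf.bsdp_of_le_norm_coeff_one_of_isIsogenous_shaAn_unit`.

All inputs PUBLISHED; no Lawson–Wuthrich, no Kolyvagin at `p`, no Keller–Yin. Census pointer (not a
verdict): iw-1's engines B (cusp-integral modular symbols) × C (twisted `L`-values) already report the
valuations `v_p(c_k)` two-engine for the X1 populations they ran (HOME/b2b-bsdres-iw-1/).

References: [Wuthrich2014] Thm. 16 (p. 397); [BalakrishnanMullerStein2015] Thm. 1.7; [PerrinRiou1987]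
§1.4 Cor. 1.8; [MazurSteinTate2006] Thm. 1.3, Conj. 1.1; [SteinWuthrich2013] §§3–4, §9;
[MatarNekovar2019] §0.10–0.11; [BurungaleSkinner2023] §2; [Miller2011LMS] Def. 1.1.
-/

noncomputable section

open scoped Classical MatrixGroups ModularForm

open CongruenceSubgroup WeierstrassCurve PowerSeries Literature.NumberTheory.EllipticCurves
  Literature.NumberTheory.EllipticCurves.ModularForms
  Literature.NumberTheory.EllipticCurves.Wuthrich2014
  Literature.NumberTheory.EllipticCurves.Rank1Residual
  Summit.BirchSwinnertonDyer.BirchSwinnertonDyer.Theorems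
  Summit.BirchSwinnertonDyer.BirchSwinnertonDyer.Theorems.Rank1ResidualX1Defs

set_option autoImplicit false

namespace Summit.BirchSwinnertonDyer.Rank1Residual.X1.RankOne

variable {W : WeierstrassCurve ℚ} [W.IsElliptic] [W.IsGloballyMinimal] {p : ℕ} [Fact p.Prime]

/-! ### §1. The route with the modular-symbol certificate `[T¹]L_p ≠ 0` -/

/-- **Per pair on the rank-one leaf, LW-free: `p ∤ #Ш(E/ℚ)_an` + `[T¹]L_p(f,α,T) ≠ 0` (for SOME
newform `f` of `E`, `α` the unit root) ⇒ Mazur's main conjecture at `(E,p)` AND `BSD(E,p)`.**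
Composition of the certificate converter `Leaf.schneider_of_coeff_one_ne_zero` (Perrin-Riou 1987 at odd
`p` + GZK: the linear coefficient is non-zero iff THE canonical cyclotomic height is non-degenerate)
with route B `Leaf.mazurMainConjecture_and_bsdp_of_shaAn_unit_of_schneider` (Wuthrich 2014 Thm. 16 —
printed for `E[p]` REDUCIBLE —, Schneider 1985 / Perrin-Riou (BMS Thm. 1.7), Perrin-Riou 1987,
Mazur–Tate sigma, modularity, GZK). Either parity type; no Heegner index, no Kolyvagin at `p`, no
irreducibility, no preprint. [cite: Wuthrich2014, Thm. 16 (p. 397)]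
[cite: BalakrishnanMullerStein2015, Thm. 1.7] [cite: PerrinRiou1987, §1.4 Cor. 1.8]
[cite: Miller2011LMS, Def. 1.1 (arXiv:1010.2431 p. 3)] -/
theorem Leaf.mazurMainConjecture_and_bsdp_of_shaAn_unit_of_coeff_one_ne_zero
    (hW16 : Wuthrich2014.charIdeal_dvd_padicLFunction) (hS : Schneider1985_order_charGenerator_odd)
    (hPR : perrinRiou_rankOne_leadingTerms_odd) (hMT : mazur_tate_sigma_exists_odd)
    (hmod : nonempty_modularParametrizationData) (hGZK : rank_eq_analyticRank_of_analyticRank_le_one)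
    (h : Leaf W p) {N : ℕ} [NeZero N] (f : CuspForm (Gamma0 N) 2) (hf : IsNewformOf W f)
    (hcoeff : coeff 1 (padicLFunction f (unitRoot W p : ℚ_[p])) ≠ 0)
    (hunit : ∃ q : ℚ, shaAn W = (q : ℂ) ∧ padicValRat p q = 0) :
    MazurMainConjecture W p ∧ BSDp W p :=
  h.mazurMainConjecture_and_bsdp_of_shaAn_unit_of_schneider hW16 hS hPR hMT hmod hGZK
    (h.schneider_of_coeff_one_ne_zero hPR hGZK f hf hcoeff) hunit

/-- **`BSD(E,p)` half** of `Leaf.mazurMainConjecture_and_bsdp_of_shaAn_unit_of_coeff_one_ne_zero`.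
[cite: Wuthrich2014, Thm. 16 (p. 397)] [cite: PerrinRiou1987, §1.4 Cor. 1.8] -/
theorem Leaf.bsdp_of_shaAn_unit_of_coeff_one_ne_zero
    (hW16 : Wuthrich2014.charIdeal_dvd_padicLFunction) (hS : Schneider1985_order_charGenerator_odd)
    (hPR : perrinRiou_rankOne_leadingTerms_odd) (hMT : mazur_tate_sigma_exists_odd)
    (hmod : nonempty_modularParametrizationData) (hGZK : rank_eq_analyticRank_of_analyticRank_le_one)
    (h : Leaf W p) {N : ℕ} [NeZero N] (f : CuspForm (Gamma0 N) 2) (hf : IsNewformOf W f)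
    (hcoeff : coeff 1 (padicLFunction f (unitRoot W p : ℚ_[p])) ≠ 0)
    (hunit : ∃ q : ℚ, shaAn W = (q : ℂ) ∧ padicValRat p q = 0) : BSDp W p :=
  (h.mazurMainConjecture_and_bsdp_of_shaAn_unit_of_coeff_one_ne_zero hW16 hS hPR hMT hmod hGZK f hf
    hcoeff hunit).2

/-! ### §2. The certificate at finite precision: a positive lower bound for `‖[T¹](ϖ·L_p)‖_p` -/

omit [W.IsElliptic] [W.IsGloballyMinimal] [Fact p.Prime] in
/-- Finite-precision form of the certificate: if `0 < c ≤ ‖[T¹](ϖ·g)‖_p` for some scalar `ϖ ∈ ℚ_p`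
(any normalisation of the `p`-adic `L`-series `g`; `[T¹](ϖ·g) = ϖ·[T¹]g`), then `[T¹]g ≠ 0`. This is
what a modular-symbol computation "`c₁ ≢ 0 (mod p^{v+1})`" certifies, with `c = p^{-v}`. [folklore] -/
theorem coeff_one_ne_zero_of_le_norm_coeff_one_smul [Fact p.Prime] (g : PowerSeries ℚ_[p]) (ϖ : ℚ_[p])
    {c : ℝ} (hc : 0 < c) (hle : c ≤ ‖coeff 1 (C ϖ * g)‖) : coeff 1 g ≠ 0 := by
  intro h0
  have hmul : coeff 1 (C ϖ * g) = 0 := by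
    rw [coeff_C_mul, h0, mul_zero]
  rw [hmul, norm_zero] at hle
  exact absurd hle (not_le.mpr hc)

/-- **Per pair on the rank-one leaf, in the currency a modular-symbol engine certifies:
`p ∤ #Ш(E/ℚ)_an` + `p^{-v} ≤ ‖[T¹](ϖ·L_p(f,α))‖_p` for some `v : ℕ` and some scalar `ϖ` (e.g. the Néron
normalisation `ϖ·Ω_E = Ω⁺_f`) ⇒ Mazur's main conjecture at `(E,p)` AND `BSD(E,p)`.** Generalises x1b's
one-number route P₁ (`Leaf.mazurMainConjecture_and_bsdp_of_norm_coeff_one_eq_one`: `v = 0`, i.e.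
`(μ_an, λ_an) = (0, 1)`, no `#Ш_an` input) to every finite valuation `v` at the price of the `#Ш_an`
certificate — on the anomalous leaf `v ≥ 1` is the typical case. PUBLISHED inputs only (Wuthrich Thm. 16,
Perrin-Riou–Schneider, Perrin-Riou 1987, Mazur–Tate sigma, modularity, GZK); no Heegner index.
[cite: Wuthrich2014, Thm. 16 (p. 397)] [cite: BalakrishnanMullerStein2015, Thm. 1.7]
[cite: PerrinRiou1987, §1.4 Cor. 1.8] [cite: SteinWuthrich2013, §§3–4, §9] -/
theorem Leaf.mazurMainConjecture_and_bsdp_of_shaAn_unit_of_le_norm_coeff_one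
    (hW16 : Wuthrich2014.charIdeal_dvd_padicLFunction) (hS : Schneider1985_order_charGenerator_odd)
    (hPR : perrinRiou_rankOne_leadingTerms_odd) (hMT : mazur_tate_sigma_exists_odd)
    (hmod : nonempty_modularParametrizationData) (hGZK : rank_eq_analyticRank_of_analyticRank_le_one)
    (h : Leaf W p) {N : ℕ} [NeZero N] (f : CuspForm (Gamma0 N) 2) (hf : IsNewformOf W f)
    (ϖ : ℚ_[p]) (v : ℕ)
    (hcoeff : (p : ℝ) ^ (-(v : ℤ)) ≤ ‖coeff 1 (C ϖ * padicLFunction f (unitRoot W p : ℚ_[p]))‖)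
    (hunit : ∃ q : ℚ, shaAn W = (q : ℂ) ∧ padicValRat p q = 0) :
    MazurMainConjecture W p ∧ BSDp W p :=
  have hpP : p.Prime := Fact.out
  h.mazurMainConjecture_and_bsdp_of_shaAn_unit_of_coeff_one_ne_zero hW16 hS hPR hMT hmod hGZK f hf
    (coeff_one_ne_zero_of_le_norm_coeff_one_smul _ ϖ
      (zpow_pos (by exact_mod_cast hpP.pos) _) hcoeff) hunit

/-- **`BSD(E,p)` half** of `Leaf.mazurMainConjecture_and_bsdp_of_shaAn_unit_of_le_norm_coeff_one`, with
the certificate as an exact valuation `‖[T¹](ϖ·L_p(f,α))‖_p = p^{-v}` (the shape of the cell's tables: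
x1a X1-CHAIN §12 `v₁₃`, iw-1 `v_k(c_k)`). [cite: Wuthrich2014, Thm. 16 (p. 397)]
[cite: PerrinRiou1987, §1.4 Cor. 1.8] -/
theorem Leaf.bsdp_of_shaAn_unit_of_norm_coeff_one_eq
    (hW16 : Wuthrich2014.charIdeal_dvd_padicLFunction) (hS : Schneider1985_order_charGenerator_odd)
    (hPR : perrinRiou_rankOne_leadingTerms_odd) (hMT : mazur_tate_sigma_exists_odd)
    (hmod : nonempty_modularParametrizationData) (hGZK : rank_eq_analyticRank_of_analyticRank_le_one)
    (h : Leaf W p) {N : ℕ} [NeZero N] (f : CuspForm (Gamma0 N) 2) (hf : IsNewformOf W f)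
    (ϖ : ℚ_[p]) (v : ℕ)
    (hcoeff : ‖coeff 1 (C ϖ * padicLFunction f (unitRoot W p : ℚ_[p]))‖ = (p : ℝ) ^ (-(v : ℤ)))
    (hunit : ∃ q : ℚ, shaAn W = (q : ℂ) ∧ padicValRat p q = 0) : BSDp W p :=
  (h.mazurMainConjecture_and_bsdp_of_shaAn_unit_of_le_norm_coeff_one hW16 hS hPR hMT hmod hGZK f hf ϖ v
    hcoeff.symm.le hunit).2

/-! ### §3. The class form (UNIT = `ℚ`-isogeny class): certificates read on any curve of the class -/

/-- **The rank-one leaf is a `ℚ`-isogeny-class notion**: for globally minimal `W ∼ W'`,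
`Leaf W p → Leaf W' p` (X1-membership by `ClassX1.of_isIsogenous` — reducibility by Brauer–Nesbitt,
good reduction, anomaly, and the parity clause transported along the isogeny —, the analytic rank by
the equality of `L`-functions, Knapp Thm. 11.67). [cite: SilvermanAEC2009, Cor. VII.7.2 and Ex. 5.4]
[cite: Knapp1993, Thm. 11.67 (PDF p. 281)] -/
theorem Leaf.of_isIsogenous {W' : WeierstrassCurve ℚ} [W'.IsElliptic] [W'.IsGloballyMinimal]
    (h : Leaf W p) (hiso : IsIsogenous W W') : Leaf W' p :=
  ⟨ClassX1.of_isIsogenous hiso h.1, (analyticRank_eq_of_isIsogenous' hiso).symm.trans h.2⟩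

/-- **Class form of the modular-symbol route: the certificates may be read on ANY curve of the class.**
For a leaf pair `(E, p)` and a globally minimal `E' ∼ E` (e.g. the curve of the class with
`p ∤ #Ш(E')_an`): `p ∤ #Ш(E')_an` + `[T¹]L_p(f,α) ≠ 0` for some newform `f` of `E'` ⇒ `BSD(E,p)` (and
`BSD(E',p)`), by `Leaf.bsdp_of_shaAn_unit_of_coeff_one_ne_zero` at the leaf pair `(E', p)`
(`Leaf.of_isIsogenous`) and Cassels' isogeny invariance of `BSD(·,p)` at analytic rank `≤ 1`
(`Rank1ResidualX1Isogeny.bsdp_iff_of_isIsogenous`: GZK, modularity `hmod'`, Cassels `hCassels`).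
PUBLISHED inputs only. [cite: Wuthrich2014, Thm. 16 (p. 397)] [cite: PerrinRiou1987, §1.4 Cor. 1.8]
[cite: MilneADT2006, Thm. I.7.3] -/
theorem Leaf.bsdp_of_isIsogenous_of_shaAn_unit_of_coeff_one_ne_zero
    (hW16 : Wuthrich2014.charIdeal_dvd_padicLFunction) (hS : Schneider1985_order_charGenerator_odd)
    (hPR : perrinRiou_rankOne_leadingTerms_odd) (hMT : mazur_tate_sigma_exists_odd)
    (hmod : nonempty_modularParametrizationData) (hmod' : hasEntireLFunction_rat)
    (hGZK : rank_eq_analyticRank_of_analyticRank_le_one) (hCassels : bsdRHS_eq_of_isIsogenous)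
    (h : Leaf W p) {W' : WeierstrassCurve ℚ} [W'.IsElliptic] [W'.IsGloballyMinimal]
    (hiso : IsIsogenous W W') {N : ℕ} [NeZero N] (f : CuspForm (Gamma0 N) 2) (hf : IsNewformOf W' f)
    (hcoeff : coeff 1 (padicLFunction f (unitRoot W' p : ℚ_[p])) ≠ 0)
    (hunit : ∃ q : ℚ, shaAn W' = (q : ℂ) ∧ padicValRat p q = 0) : BSDp W p :=
  (Rank1ResidualX1Isogeny.bsdp_iff_of_isIsogenous hGZK hmod' hCassels W W' hiso p (by rw [h.2])).mpr
    ((h.of_isIsogenous hiso).bsdp_of_shaAn_unit_of_coeff_one_ne_zero hW16 hS hPR hMT hmod hGZK f hf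
      hcoeff hunit)

/-- **Class form in finite-precision currency:** leaf pair `(E, p)`, globally minimal `E' ∼ E`,
`p ∤ #Ш(E')_an` and `p^{-v} ≤ ‖[T¹](ϖ·L_p(f,α))‖_p` for some `v : ℕ`, scalar `ϖ` and newform `f` of `E'`
⇒ `BSD(E,p)`. [cite: Wuthrich2014, Thm. 16 (p. 397)] [cite: PerrinRiou1987, §1.4 Cor. 1.8]
[cite: MilneADT2006, Thm. I.7.3] -/
theorem Leaf.bsdp_of_isIsogenous_of_shaAn_unit_of_le_norm_coeff_one
    (hW16 : Wuthrich2014.charIdeal_dvd_padicLFunction) (hS : Schneider1985_order_charGenerator_odd)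
    (hPR : perrinRiou_rankOne_leadingTerms_odd) (hMT : mazur_tate_sigma_exists_odd)
    (hmod : nonempty_modularParametrizationData) (hmod' : hasEntireLFunction_rat)
    (hGZK : rank_eq_analyticRank_of_analyticRank_le_one) (hCassels : bsdRHS_eq_of_isIsogenous)
    (h : Leaf W p) {W' : WeierstrassCurve ℚ} [W'.IsElliptic] [W'.IsGloballyMinimal]
    (hiso : IsIsogenous W W') {N : ℕ} [NeZero N] (f : CuspForm (Gamma0 N) 2) (hf : IsNewformOf W' f)
    (ϖ : ℚ_[p]) (v : ℕ)
    (hcoeff : (p : ℝ) ^ (-(v : ℤ)) ≤ ‖coeff 1 (C ϖ * padicLFunction f (unitRoot W' p : ℚ_[p]))‖)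
    (hunit : ∃ q : ℚ, shaAn W' = (q : ℂ) ∧ padicValRat p q = 0) : BSDp W p :=
  (Rank1ResidualX1Isogeny.bsdp_iff_of_isIsogenous hGZK hmod' hCassels W W' hiso p (by rw [h.2])).mpr
    ((h.of_isIsogenous hiso).mazurMainConjecture_and_bsdp_of_shaAn_unit_of_le_norm_coeff_one hW16 hS hPR
      hMT hmod hGZK f hf ϖ v hcoeff hunit).2

/-! ### §4. Booking form: the `L_p`-certificate read on `E`, the `#Ш_an` bit on any `E' ∼ E` -/

omit [W.IsElliptic] in
/-- The unit root `α` is a `ℚ`-isogeny-class invariant on the leaf (it is defined from `a_p`, and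
`a_p(E) = a_p(E')` for isogenous curves with good reduction at `p` — Faltings / Silverman Ex. 5.4).
[cite: Faltings1983Endlichkeit, §5 Korollar 2, (i) ⇒ (iv)] [cite: SilvermanAEC2009, Exercise 5.4(a)] -/
theorem Leaf.unitRoot_eq_of_isIsogenous [W.IsElliptic] {W' : WeierstrassCurve ℚ} [W'.IsElliptic]
    [W'.IsGloballyMinimal] (h : Leaf W p) (hiso : IsIsogenous W W') : unitRoot W p = unitRoot W' p := by
  have hg : W.HasGoodReductionAtPrime p := h.1.2.2.1
  have hg' : W'.HasGoodReductionAtPrime p := (hiso.hasGoodReductionAtPrime_iff p).mp hg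
  have e : W.frobeniusTrace p = W'.frobeniusTrace p :=
    WeierstrassCurve.frobeniusTrace_eq_of_isIsogenous hiso p hg hg'
  unfold unitRoot
  rw [e]

/-- **Booking form of the class route.** The `p`-adic `L`-series is attached to the CLASS (the newform
`f` of `E` is the newform of every `E' ∼ E` — equal `L`-functions; the unit root is a class
invariant, `Leaf.unitRoot_eq_of_isIsogenous`), while `#Ш_an` is read per curve. So: leaf pair `(E, p)`,
`[T¹]L_p(f,α) ≠ 0` for a newform `f` of `E`, and `p ∤ #Ш(E')_an` for SOME globally minimal `E' ∼ E`
⇒ `BSD(E,p)`. PUBLISHED inputs only (Wuthrich Thm. 16, Perrin-Riou–Schneider, Perrin-Riou 1987,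
Mazur–Tate sigma, modularity, GZK, Cassels). [cite: Wuthrich2014, Thm. 16 (p. 397)]
[cite: PerrinRiou1987, §1.4 Cor. 1.8] [cite: MilneADT2006, Thm. I.7.3] [cite: Knapp1993, Thm. 11.67 (PDF p. 281)] -/
theorem Leaf.bsdp_of_coeff_one_ne_zero_of_isIsogenous_shaAn_unit
    (hW16 : Wuthrich2014.charIdeal_dvd_padicLFunction) (hS : Schneider1985_order_charGenerator_odd)
    (hPR : perrinRiou_rankOne_leadingTerms_odd) (hMT : mazur_tate_sigma_exists_odd)
    (hmod : nonempty_modularParametrizationData) (hmod' : hasEntireLFunction_rat)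
    (hGZK : rank_eq_analyticRank_of_analyticRank_le_one) (hCassels : bsdRHS_eq_of_isIsogenous)
    (h : Leaf W p) {N : ℕ} [NeZero N] (f : CuspForm (Gamma0 N) 2) (hf : IsNewformOf W f)
    (hcoeff : coeff 1 (padicLFunction f (unitRoot W p : ℚ_[p])) ≠ 0)
    {W' : WeierstrassCurve ℚ} [W'.IsElliptic] [W'.IsGloballyMinimal] (hiso : IsIsogenous W W')
    (hunit : ∃ q : ℚ, shaAn W' = (q : ℂ) ∧ padicValRat p q = 0) : BSDp W p :=
  -- the newform of `E` is the newform of `E'` (equal `L`-functions, Knapp Thm. 11.67)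
  have hf' : IsNewformOf W' f := ⟨hf.1, fun n ↦ by rw [hf.2 n, hiso.LFunction_eq]⟩
  h.bsdp_of_isIsogenous_of_shaAn_unit_of_coeff_one_ne_zero hW16 hS hPR hMT hmod hmod' hGZK hCassels hiso f
    hf' (by rwa [← h.unitRoot_eq_of_isIsogenous hiso]) hunit

/-- **Booking form, finite-precision currency:** leaf pair `(E, p)`, `p^{-v} ≤ ‖[T¹](ϖ·L_p(f,α))‖_p` for a
newform `f` of `E`, some `v : ℕ` and scalar `ϖ`, and `p ∤ #Ш(E')_an` for some globally minimal `E' ∼ E`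
⇒ `BSD(E,p)`. [cite: Wuthrich2014, Thm. 16 (p. 397)] [cite: PerrinRiou1987, §1.4 Cor. 1.8]
[cite: MilneADT2006, Thm. I.7.3] -/
theorem Leaf.bsdp_of_le_norm_coeff_one_of_isIsogenous_shaAn_unit
    (hW16 : Wuthrich2014.charIdeal_dvd_padicLFunction) (hS : Schneider1985_order_charGenerator_odd)
    (hPR : perrinRiou_rankOne_leadingTerms_odd) (hMT : mazur_tate_sigma_exists_odd)
    (hmod : nonempty_modularParametrizationData) (hmod' : hasEntireLFunction_rat)
    (hGZK : rank_eq_analyticRank_of_analyticRank_le_one) (hCassels : bsdRHS_eq_of_isIsogenous)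
    (h : Leaf W p) {N : ℕ} [NeZero N] (f : CuspForm (Gamma0 N) 2) (hf : IsNewformOf W f)
    (ϖ : ℚ_[p]) (v : ℕ)
    (hcoeff : (p : ℝ) ^ (-(v : ℤ)) ≤ ‖coeff 1 (C ϖ * padicLFunction f (unitRoot W p : ℚ_[p]))‖)
    {W' : WeierstrassCurve ℚ} [W'.IsElliptic] [W'.IsGloballyMinimal] (hiso : IsIsogenous W W')
    (hunit : ∃ q : ℚ, shaAn W' = (q : ℂ) ∧ padicValRat p q = 0) : BSDp W p :=
  have hpP : p.Prime := Fact.out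
  h.bsdp_of_coeff_one_ne_zero_of_isIsogenous_shaAn_unit hW16 hS hPR hMT hmod hmod' hGZK hCassels f hf
    (coeff_one_ne_zero_of_le_norm_coeff_one_smul _ ϖ (zpow_pos (by exact_mod_cast hpP.pos) _) hcoeff)
    hiso hunit

end Summit.BirchSwinnertonDyer.Rank1Residual.X1.RankOne

end
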